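import Literature.NumberTheory.NumberFields.DifferentTameRamification
import Literature.NumberTheory.NumberFields.DedekindDifferentBoundRelative
import Literature.NumberTheory.NumberFields.UnramifiedDescentPrimeDegree
import Mathlib.NumberTheory.NumberField.Discriminant.Different
import HarnessLib

/-!
# Exponents of the relative different `𝔇_{K/F}` of number fields, prime by prime

Topic `NumberTheory/NumberFields`; theorems only (no definition, no named fact). For a finite
extension of number fields `F ⊆ K` (`𝓞 F ⊆ 𝓞 K` Dedekind, `𝔇_{K/F} = differentIdeal (𝓞 F) (𝓞 K)`)
and a maximal ideal `P` of `𝓞 K` with relative ramification index `e = e(P | P ∩ 𝓞 F)`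
(Mathlib `P.ramificationIdx (𝓞 F)`), absolute ramification index `e_P = e(P | p)`
(`P.ramificationIdx ℤ`) and residue characteristic `p` (`Ideal.absNorm (P.under ℤ)`), the exponent
`ord_P 𝔇_{K/F}` (`multiplicity P (differentIdeal (𝓞 F) (𝓞 K))`) satisfies:

* `ramificationIdx_sub_one_le_multiplicity_differentIdeal` — **`e - 1 ≤ ord_P 𝔇_{K/F}`** (Neukirch III (2.6);
  Mathlib `pow_sub_one_dvd_differentIdeal`, with the separability of `Frac 𝓞 K / Frac 𝓞 F` supplied);
* `multiplicity_differentIdeal_le_of_not_dvd`, `…_eq_of_not_dvd` — **tame: `p ∤ e ⇒ ord_P 𝔇_{K/F} = e - 1`**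
  (Serre, *Corps locaux* III §6 Prop. 13, from the tree's
  `Literature.NumberTheory.NumberFields.not_pow_dvd_differentIdeal_of_natCast_ramificationIdx_notMem`);
* `multiplicity_differentIdeal_eq_zero_of_ramificationIdx_eq_one` — **unramified: `e = 1 ⇒ ord_P 𝔇_{K/F} = 0`**;
* `multiplicity_differentIdeal_succ_le_of_isGalois` — **Galois: `ord_P 𝔇_{K/F} ≤ e - 1 + ord_P(e)`**
  (Bombieri–Gubler, Thm. B.2.11, the tree's
  `Literature.NumberTheory.NumberFields.succ_le_ramificationIdx_add_multiplicity_of_pow_dvd_differentIdeal_rel`),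
  and the explicit form `multiplicity_differentIdeal_lt_of_isGalois`:
  **`[K:F] ∣ N ⇒ ord_P 𝔇_{K/F} < e_P · (v_p(N) + 1)`**, through `ord_P((N)) = e_P · v_p(N)`
  (`multiplicity_span_natCast`), `e ∣ [K:F]` for `K/F` Galois (the tree's
  `ramificationIdx_dvd_finrank_of_isGalois`, `g·e·f = [K:F]`) and `e ∣ e_P`
  (`ramificationIdx_rel_dvd_ramificationIdx_int`).

These are the per-prime inputs of [IUTchIV] Prop. 1.3 / Thm. 1.10 Step (ii) in GLOBAL form (the
log-different bookkeeping over them is `Literature/IUT/LogVolume/DifferentConductorTower.lean`).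
Classical algebraic number theory; nothing here belongs to the disputed corpus.

## References

* J. Neukirch, *Algebraic Number Theory*, Springer (1999), Ch. III (2.6) Theorem ("`s = e - 1` if `𝔓` is
  tamely ramified, `e ≤ s ≤ e - 1 + v_𝔓(e)` if `𝔓` is wildly ramified", `𝔓^s ∥ 𝔇_{L|K}`), Ch. III (1.6),
  Ch. I (8.2) (fundamental identity `Σ e_i f_i = n`), Ch. I (9.3) (`n = efr` in the Galois case) — read on
  the page (held text `book:bynd-algebraic-number-theory`). [NeukirchANT1999]
* J.-P. Serre, *Local Fields* (Corps locaux), GTM 67 (1979), Ch. III §6 Prop. 13 (the tree's tame lemma).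
  [Serre1979]
* E. Bombieri, W. Gubler, *Heights in Diophantine Geometry*, CUP (2006), App. B, Thm. B.2.11 (the tree's
  Galois upper bound). [BombieriGubler2006]
-/

noncomputable section

open NumberField IsDedekindDomain Ideal UniqueFactorizationMonoid

namespace Literature.NumberTheory.NumberFields

variable (F K : Type*) [Field F] [NumberField F] [Field K] [NumberField K] [Algebra F K]

/-- `Frac(𝓞 K) / Frac(𝓞 F)` is separable (for Mathlib's different lemmas, which are stated over the
abstract fraction rings; transported from `K/F`, characteristic `0`).
[cite: NeukirchANT1999, Ch. III (2.6)] -/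
theorem isSeparable_fractionRing_ringOfIntegers :
    letI := FractionRing.liftAlgebra (𝓞 F) (FractionRing (𝓞 K))
    Algebra.IsSeparable (FractionRing (𝓞 F)) (FractionRing (𝓞 K)) := by
  letI := FractionRing.liftAlgebra (𝓞 F) (FractionRing (𝓞 K))
  exact isSeparable_fractionRing_of_isSeparable (𝓞 F) F K (𝓞 K)

/-- **`P^{e-1} ∣ 𝔇_{K/F}`** for a maximal ideal `P` of `𝓞 K`, `e = e(P | P ∩ 𝓞 F)` (Dedekind; Mathlib
`pow_sub_one_dvd_differentIdeal`). Printed: "the exponent of `𝔓` in the different `𝔇_{B/A}` is greater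
than or equal to `e_𝔓 - 1`". [cite: NeukirchANT1999, Ch. III (2.6)] -/
theorem pow_ramificationIdx_sub_one_dvd_differentIdeal_rel (P : Ideal (𝓞 K)) [P.IsMaximal] :
    P ^ (P.ramificationIdx (𝓞 F) - 1) ∣ differentIdeal (𝓞 F) (𝓞 K) := by
  classical
  have hP : P ≠ ⊥ := Ideal.IsMaximal.ne_bot_of_isIntegral_int P
  have hp : P.under (𝓞 F) ≠ ⊥ := under_ne_bot (𝓞 F) hP
  haveI : (P.under (𝓞 F)).IsMaximal := IsMaximal.under (𝓞 F) P
  letI := FractionRing.liftAlgebra (𝓞 F) (FractionRing (𝓞 K))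
  haveI := isSeparable_fractionRing_ringOfIntegers F K
  have hPe : P ^ P.ramificationIdx (𝓞 F) ∣ (P.under (𝓞 F)).map (algebraMap (𝓞 F) (𝓞 K)) := by
    rw [← ramificationIdx'_eq_ramificationIdx (P.under (𝓞 F)) P hp, dvd_iff_le]
    exact le_pow_ramificationIdx'
  exact pow_sub_one_dvd_differentIdeal (𝓞 F) P _ hp hPe

/-- **`e - 1 ≤ ord_P 𝔇_{K/F}`** (exponent form of `P^{e-1} ∣ 𝔇_{K/F}`).
[cite: NeukirchANT1999, Ch. III (2.6)] -/
theorem ramificationIdx_sub_one_le_multiplicity_differentIdeal (P : Ideal (𝓞 K)) [P.IsMaximal] :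
    P.ramificationIdx (𝓞 F) - 1 ≤ multiplicity P (differentIdeal (𝓞 F) (𝓞 K)) := by
  have hP : P ≠ ⊥ := Ideal.IsMaximal.ne_bot_of_isIntegral_int P
  have hD : differentIdeal (𝓞 F) (𝓞 K) ≠ ⊥ := differentIdeal_ne_bot
  exact (FiniteMultiplicity.of_prime_left (prime_of_isPrime hP inferInstance) hD).le_multiplicity_of_pow_dvd
    (pow_ramificationIdx_sub_one_dvd_differentIdeal_rel F K P)

end Literature.NumberTheory.NumberFields

end

namespace Literature.NumberTheory.NumberFields

open NumberField IsDedekindDomain Ideal UniqueFactorizationMonoid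

variable (F K : Type*) [Field F] [NumberField F] [Field K] [NumberField K] [Algebra F K]

omit [NumberField K] in
/-- The residue characteristic `p` of `P` (the positive generator of `P ∩ ℤ`) divides `n` iff
`(n : 𝓞 K) ∈ P`. [cite: NeukirchANT1999, Ch. I (8.2)] -/
theorem natCast_mem_iff_absNorm_under_dvd (P : Ideal (𝓞 K)) (n : ℕ) :
    (n : 𝓞 K) ∈ P ↔ Ideal.absNorm (P.under ℤ) ∣ n := by
  have h1 : (n : 𝓞 K) ∈ P ↔ (n : ℤ) ∈ P.under ℤ := by
    rw [Ideal.mem_comap]; simp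
  have h3 : P.under ℤ = Ideal.span {(Ideal.absNorm (P.under ℤ) : ℤ)} :=
    (Int.liesOver_span_absNorm P).over.symm
  rw [h1]
  conv_lhs => rw [h3]
  rw [Ideal.mem_span_singleton, Int.natCast_dvd_natCast]

omit [NumberField F] [NumberField K] in
/-- The residue characteristic `p` of `P` divides `n` iff `(n : 𝓞 F) ∈ P ∩ 𝓞 F`.
[cite: NeukirchANT1999, Ch. I (8.2)] -/
theorem natCast_mem_under_iff (P : Ideal (𝓞 K)) (n : ℕ) :
    ((n : ℕ) : 𝓞 F) ∈ P.under (𝓞 F) ↔ Ideal.absNorm (P.under ℤ) ∣ n := by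
  rw [← natCast_mem_iff_absNorm_under_dvd K P n, Ideal.mem_comap, map_natCast]

/-- **Tame case: `p ∤ e ⇒ ord_P 𝔇_{K/F} ≤ e - 1`** (`P^e ∤ 𝔇_{K/F}`; `p` the residue characteristic of
`P`, `e = e(P | P ∩ 𝓞 F)`). Printed: "with equality taking place if and only if `e_𝔓` is prime to the
characteristic of the residue field" (the tree's trace-form proof
`not_pow_dvd_differentIdeal_of_natCast_ramificationIdx_notMem`, with the factorisation
`(P ∩ 𝓞 F)·𝓞 K = P^e · I`, `P + I = 𝓞 K` from Mathlib's `Ideal.eq_prime_pow_mul_coprime` and the finite,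
hence perfect, residue field of `P ∩ 𝓞 F`). [cite: NeukirchANT1999, Ch. III (2.6)] -/
theorem multiplicity_differentIdeal_le_of_not_dvd (P : Ideal (𝓞 K)) [P.IsMaximal]
    (htame : ¬ (Ideal.absNorm (P.under ℤ) ∣ P.ramificationIdx (𝓞 F))) :
    multiplicity P (differentIdeal (𝓞 F) (𝓞 K)) ≤ P.ramificationIdx (𝓞 F) - 1 := by
  classical
  have hP : P ≠ ⊥ := Ideal.IsMaximal.ne_bot_of_isIntegral_int P
  set p := P.under (𝓞 F) with hpdef
  have hp : p ≠ ⊥ := under_ne_bot (𝓞 F) hP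
  haveI : p.IsMaximal := IsMaximal.under (𝓞 F) P
  have hp' : p.map (algebraMap (𝓞 F) (𝓞 K)) ≠ ⊥ := map_ne_bot_of_ne_bot hp
  set e := P.ramificationIdx (𝓞 F) with hedef
  have he0 : e ≠ 0 := (Ideal.ramificationIdx_pos P (𝓞 F)).ne'
  -- factorisation `p 𝓞_K = P^e * I`, `P ⊔ I = ⊤`
  obtain ⟨I, hcop, hfac⟩ := Ideal.eq_prime_pow_mul_coprime hp' P
  rw [← IsDedekindDomain.ramificationIdx_eq_normalizedFactors_count p P hp'] at hfac
  -- instances for the tree lemma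
  haveI : (P ^ e).LiesOver p := by
    constructor
    refine le_antisymm ?_ ?_
    · rw [← Ideal.map_le_iff_le_comap, hfac]; exact Ideal.mul_le_right
    · calc (P ^ e).under (𝓞 F) ≤ P.under (𝓞 F) := Ideal.comap_mono (Ideal.pow_le_self he0)
        _ = p := rfl
  letI := Ideal.Quotient.field p
  letI := Ideal.Quotient.field P
  haveI : Finite (𝓞 F ⧸ p) := Ideal.finiteQuotientOfFreeOfNeBot p hp
  haveI : Algebra.IsAlgebraic (𝓞 F ⧸ p) (𝓞 K ⧸ P) := Algebra.IsAlgebraic.of_finite _ _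
  have key := not_pow_dvd_differentIdeal_of_natCast_ramificationIdx_notMem (𝓞 F) F K (𝓞 K) hp P
    hfac hcop (by rwa [natCast_mem_under_iff])
  -- `¬ P^e ∣ 𝔇` ⇒ multiplicity < e
  have : multiplicity P (differentIdeal (𝓞 F) (𝓞 K)) < e := by
    by_contra h
    exact key (pow_dvd_of_le_multiplicity (not_lt.mp h))
  omega

/-- **Tame case, exact: `p ∤ e ⇒ ord_P 𝔇_{K/F} = e - 1`.** [cite: NeukirchANT1999, Ch. III (2.6)] -/
theorem multiplicity_differentIdeal_eq_of_not_dvd (P : Ideal (𝓞 K)) [P.IsMaximal]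
    (htame : ¬ (Ideal.absNorm (P.under ℤ) ∣ P.ramificationIdx (𝓞 F))) :
    multiplicity P (differentIdeal (𝓞 F) (𝓞 K)) = P.ramificationIdx (𝓞 F) - 1 :=
  le_antisymm (multiplicity_differentIdeal_le_of_not_dvd F K P htame)
    (ramificationIdx_sub_one_le_multiplicity_differentIdeal F K P)

/-- **Unramified case: `e = 1 ⇒ ord_P 𝔇_{K/F} = 0`** (`P ∤ 𝔇_{K/F}`; the case `e = 1` of the tame
equality, `p ∤ 1`). [cite: NeukirchANT1999, Ch. III (2.6)] -/
theorem multiplicity_differentIdeal_eq_zero_of_ramificationIdx_eq_one (P : Ideal (𝓞 K)) [P.IsMaximal]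
    (h : P.ramificationIdx (𝓞 F) = 1) : multiplicity P (differentIdeal (𝓞 F) (𝓞 K)) = 0 := by
  have := multiplicity_differentIdeal_eq_of_not_dvd F K P (by
    rw [h, Nat.dvd_one]
    haveI : NeZero P := ⟨Ideal.IsMaximal.ne_bot_of_isIntegral_int P⟩
    exact (Nat.absNorm_under_prime P).ne_one)
  rw [this, h]

/-- **Galois case: `ord_P 𝔇_{K/F} ≤ e - 1 + ord_P(e)`** for `K/F` Galois (Dedekind's different theorem,
upper bound; the tree's `succ_le_ramificationIdx_add_multiplicity_of_pow_dvd_differentIdeal_rel` at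
`j = ord_P 𝔇_{K/F}`). [cite: BombieriGubler2006, Thm. B.2.11] -/
theorem multiplicity_differentIdeal_succ_le_of_isGalois [IsGalois F K] (P : Ideal (𝓞 K))
    [P.IsMaximal] :
    multiplicity P (differentIdeal (𝓞 F) (𝓞 K)) + 1 ≤ P.ramificationIdx (𝓞 F) +
      multiplicity P (Ideal.span {((P.ramificationIdx (𝓞 F) : ℕ) : 𝓞 K)}) :=
  succ_le_ramificationIdx_add_multiplicity_of_pow_dvd_differentIdeal_rel F K P
    (Ideal.IsMaximal.ne_bot_of_isIntegral_int P) (pow_multiplicity_dvd _ _)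

omit [NumberField F] [Algebra F K] in
/-- `ord_P((n)) ≤ ord_P((N))` for `n ∣ N`, `N ≠ 0`. [cite: NeukirchANT1999, Ch. I (8.2)] -/
theorem multiplicity_span_natCast_mono (P : Ideal (𝓞 K)) [P.IsMaximal] {n N : ℕ} (hN : N ≠ 0)
    (h : n ∣ N) :
    multiplicity P (Ideal.span {(n : 𝓞 K)}) ≤ multiplicity P (Ideal.span {(N : 𝓞 K)}) := by
  have hP : P ≠ ⊥ := Ideal.IsMaximal.ne_bot_of_isIntegral_int P
  have hNK : Ideal.span {(N : 𝓞 K)} ≠ ⊥ := by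
    rw [Ne, Ideal.span_singleton_eq_bot, Nat.cast_eq_zero]; exact hN
  have hfin := FiniteMultiplicity.of_prime_left (prime_of_isPrime hP inferInstance) hNK
  refine hfin.le_multiplicity_of_pow_dvd ((pow_multiplicity_dvd _ _).trans ?_)
  exact Ideal.dvd_iff_le.mpr (Ideal.span_singleton_le_span_singleton.mpr (Nat.cast_dvd_cast h))

omit [NumberField F] [Algebra F K] in
/-- `ord_P((p)) = e(P | p)` for the residue characteristic `p` of `P` (the definition of the absolute
ramification index, Mathlib `ramificationIdx_eq_multiplicity`). [cite: NeukirchANT1999, Ch. I (8.2)] -/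
theorem multiplicity_span_residueChar (P : Ideal (𝓞 K)) [P.IsMaximal] :
    multiplicity P (Ideal.span {((Ideal.absNorm (P.under ℤ) : ℕ) : 𝓞 K)}) = P.ramificationIdx ℤ := by
  haveI : NeZero P := ⟨Ideal.IsMaximal.ne_bot_of_isIntegral_int P⟩
  set p : ℕ := Ideal.absNorm (P.under ℤ) with hpdef
  have hp : p.Prime := Nat.absNorm_under_prime P
  haveI : P.LiesOver (Ideal.span {(p : ℤ)}) := Int.liesOver_span_absNorm P
  have hmap : (Ideal.span {(p : ℤ)}).map (algebraMap ℤ (𝓞 K)) = Ideal.span {(p : 𝓞 K)} := by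
    rw [Ideal.map_span, Set.image_singleton, map_natCast]
  have hpb : (Ideal.span {(p : ℤ)}).map (algebraMap ℤ (𝓞 K)) ≠ ⊥ := by
    rw [hmap, Ne, Ideal.span_singleton_eq_bot, Nat.cast_eq_zero]
    exact hp.ne_zero
  rw [IsDedekindDomain.ramificationIdx_eq_multiplicity (Ideal.span {(p : ℤ)}) P hpb, hmap]

omit [NumberField F] [Algebra F K] in
/-- **`ord_P((N)) = e(P | p) · v_p(N)`** for `N ≠ 0`, `p` the residue characteristic of `P`
(`N = p^{v_p(N)}·m`, `p ∤ m`, `m ∉ P`). [cite: NeukirchANT1999, Ch. I (8.2)] -/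
theorem multiplicity_span_natCast (P : Ideal (𝓞 K)) [P.IsMaximal] {N : ℕ} (hN : N ≠ 0) :
    multiplicity P (Ideal.span {(N : 𝓞 K)}) =
      P.ramificationIdx ℤ * N.factorization (Ideal.absNorm (P.under ℤ)) := by
  haveI : NeZero P := ⟨Ideal.IsMaximal.ne_bot_of_isIntegral_int P⟩
  have hP : P ≠ ⊥ := Ideal.IsMaximal.ne_bot_of_isIntegral_int P
  have hPp := prime_of_isPrime hP (inferInstance : P.IsPrime)
  set p : ℕ := Ideal.absNorm (P.under ℤ) with hpdef
  have hp : p.Prime := Nat.absNorm_under_prime P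
  -- `N = p^a * m`, `p ∤ m`
  obtain ⟨a, m, hm, hNeq⟩ := Nat.exists_eq_pow_mul_and_not_dvd hN p hp.ne_one
  have ha : N.factorization p = a := by
    rw [hNeq, Nat.factorization_mul (pow_ne_zero _ hp.ne_zero) (by rintro rfl; simp at hm),
      Finsupp.add_apply, hp.factorization_pow, Finsupp.single_eq_same,
      Nat.factorization_eq_zero_of_not_dvd hm, add_zero]
  rw [ha]
  have hsplit : Ideal.span {(N : 𝓞 K)} = Ideal.span {(p : 𝓞 K)} ^ a * Ideal.span {(m : 𝓞 K)} := by
    rw [Ideal.span_singleton_pow, Ideal.span_singleton_mul_span_singleton, hNeq]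
    push_cast
    rfl
  have hNK : Ideal.span {(N : 𝓞 K)} ≠ ⊥ := by
    rw [Ne, Ideal.span_singleton_eq_bot, Nat.cast_eq_zero]; exact hN
  have hfin := FiniteMultiplicity.of_prime_left hPp hNK
  rw [hsplit] at hfin ⊢
  have hpK : Ideal.span {(p : 𝓞 K)} ≠ ⊥ := by
    rw [Ne, Ideal.span_singleton_eq_bot, Nat.cast_eq_zero]; exact hp.ne_zero
  rw [multiplicity_mul hPp hfin, (FiniteMultiplicity.of_prime_left hPp hpK).multiplicity_pow hPp,
    multiplicity_span_residueChar K P]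
  -- `ord_P((m)) = 0` since `m ∉ P`
  have hm0 : multiplicity P (Ideal.span {(m : 𝓞 K)}) = 0 := by
    rw [multiplicity_eq_zero, Ideal.dvd_span_singleton, natCast_mem_iff_absNorm_under_dvd]
    exact hm
  rw [hm0, add_zero, mul_comm]

omit [NumberField K] in
/-- `e(P | P ∩ 𝓞 F) ∣ e(P | p)`: multiplicativity ("transitivity") of ramification indices along
`ℤ ⊆ 𝓞 F ⊆ 𝓞 K` (Mathlib `Ideal.ramificationIdx_tower`). [cite: NeukirchANT1999, Ch. III (1.6)] -/
theorem ramificationIdx_rel_dvd_ramificationIdx_int (P : Ideal (𝓞 K)) [P.IsMaximal] :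
    P.ramificationIdx (𝓞 F) ∣ P.ramificationIdx ℤ :=
  ⟨(P.under (𝓞 F)).ramificationIdx ℤ, by
    rw [Ideal.ramificationIdx_tower (R := ℤ) (P.under (𝓞 F)) P, mul_comm]⟩

/-- **Galois case, explicit: `[K:F] ∣ N ⇒ ord_P 𝔇_{K/F} + 1 ≤ e_P · (v_p(N) + 1)`** for `K/F` Galois,
`N ≠ 0`, `p` the residue characteristic and `e_P = e(P | p)` the absolute ramification index of `P`
(from `ord_P 𝔇 ≤ e - 1 + ord_P(e)` with `e = e(P | P ∩ 𝓞 F) ∣ [K:F] ∣ N`, `ord_P((N)) = e_P·v_p(N)`,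
`e ≤ e_P`). This is the shape in which [IUTchIV] Thm. 1.10 Step (ii) uses Prop. 1.3 (ii) at the primes
over `2·3·5` (`Gal(F/F_tpd) ↪ GL₂(𝔽₃) × GL₂(𝔽₅) × ℤ/2ℤ`) and over `l` (`Gal(K/F) ↪ GL₂(𝔽_l)`).
[cite: BombieriGubler2006, Thm. B.2.11] -/
theorem multiplicity_differentIdeal_lt_of_isGalois [IsGalois F K] (P : Ideal (𝓞 K)) [P.IsMaximal]
    {N : ℕ} (hN : N ≠ 0) (hdvd : Module.finrank F K ∣ N) :
    multiplicity P (differentIdeal (𝓞 F) (𝓞 K)) + 1 ≤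
      P.ramificationIdx ℤ * (N.factorization (Ideal.absNorm (P.under ℤ)) + 1) := by
  have h1 := multiplicity_differentIdeal_succ_le_of_isGalois F K P
  have h2 := multiplicity_span_natCast_mono K P hN
    ((ramificationIdx_dvd_finrank_of_isGalois (P.under (𝓞 F)) P).trans hdvd)
  rw [multiplicity_span_natCast K P hN] at h2
  have h3 := Nat.le_of_dvd (Ideal.ramificationIdx_pos P ℤ) (ramificationIdx_rel_dvd_ramificationIdx_int F K P)
  nlinarith

end Literature.NumberTheory.NumberFields
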